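import Literature.AlgebraicGeometry.Modules.CechEndCochainDifferential
import Literature.AlgebraicGeometry.Modules.CechThetaVanishing
import HarnessLib

/-!
# Matrix cochains in a framing versus cochains of local homomorphisms

Bridge between the two presentations of Čech cochains of `𝓔nd(E)` in the tree: the MATRIX cochains
`𝔣.Cochain n` of a framing `𝔣 = (U_a, I_a, e_a)` (`Modules/CechEndCochain.lean`, seat 2 of crux
`PadicPridhamSemiregularity`) and the cochains of LOCAL HOMOMORPHISMS
`Cech.LocalFamily U n E E = ∀ α, E|_{U_α} → E|_{U_α}` (`Modules/CechTheta.lean`, seat 1), whose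
`Ext`-classes `Cech.classOf` are defined through `Cech.familyHom`.

* `Framing.toLocalFamily c` — the family `α ↦ op_{α₀ αₙ}(X_α)` over `U_α`;
  `familyHom (toLocalFamily c) = toEnd n c` (`familyHom_toLocalFamily`);
* since a family of local homomorphisms is determined by `ω♯` (`Cech.familyHom_injective`,
  `Modules/CechThetaVanishing.lean`), **`dFamily (toLocalFamily c) = toLocalFamily (D₁ c)`**, resp. `(D₂ c)`
  (`dFamily_toLocalFamily_one/two`, from `toEnd_comp_d_one/two`), and `toLocalFamily` is injective;
* `endMatrix e k φ` — the matrix of an endomorphism of `E|_V` in a frame of `E|_W ⊇ E|_V`, with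
  `matrixEnd e k (endMatrix e k φ) = φ` (`Modules/FrameMatrixEnd.lean` gives the converse);
* `Framing.ofLocalFamily₁ β` — **every `1`-cochain of local endomorphisms is a matrix `1`-cochain**:
  `toLocalFamily (ofLocalFamily₁ β) = β`. Consequently a matrix `2`-cochain `c` whose family is a
  coboundary, `toLocalFamily c = dFamily β`, satisfies `c = D₁ (ofLocalFamily₁ β)`
  (`eq_D₁_of_toLocalFamily_eq_dFamily`) — the form in which the vanishing of an obstruction CLASS
  is fed back into transition matrices.

Everything is proved; no named facts.

## References

* R. Hartshorne, *Algebraic Geometry*, GTM 52 (1977), III.4. [Hartshorne1977]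
* R. Godement, *Topologie algébrique et théorie des faisceaux* (1958), II.5.
-/

noncomputable section

open CategoryTheory AlgebraicGeometry Opposite TopologicalSpace Limits

namespace Literature.AlgebraicGeometry.Modules

open Literature.AlgebraicGeometry.Motives

universe u

variable {X : Scheme.{u}} {E M : X.Modules} {ι : Type u}

/-! ### From matrix cochains to families of local homomorphisms -/

namespace Framing

variable (𝔣 : Framing E ι) {n : ℕ}

/-- `V ≤ U_α` from `V ≤ U_{α_k}` for all `k`. [folklore] -/
lemma le_face_of_forall {V : X.Opens} {α : Fin (n + 1) → ι} (hV : ∀ k, V ≤ 𝔣.U (α k)) : V ≤ face 𝔣.U α :=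
  le_iInf hV

/-- **The family of local endomorphisms `α ↦ op_{α₀ αₙ}(X_α) : E|_{U_α} → E|_{U_α}` of a matrix cochain.**
[folklore] -/
def toLocalFamily (c : 𝔣.Cochain n) : Cech.LocalFamily 𝔣.U n E E := fun α =>
  𝔣.op (α 0) (α (Fin.last n)) (face 𝔣.U α) (face_le 𝔣.U α 0) (face_le 𝔣.U α (Fin.last n))
    (c.mat α (face 𝔣.U α) (face_le 𝔣.U α))

/-- Components of `toLocalFamily`. [folklore] -/
lemma toLocalFamily_apply (c : 𝔣.Cochain n) (α : Fin (n + 1) → ι) :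
    𝔣.toLocalFamily c α = 𝔣.op (α 0) (α (Fin.last n)) (face 𝔣.U α) (face_le 𝔣.U α 0)
      (face_le 𝔣.U α (Fin.last n)) (c.mat α (face 𝔣.U α) (face_le 𝔣.U α)) := rfl

/-- Restricting the local endomorphism of a cochain to a smaller open. [folklore] -/
lemma restrictHom_toLocalFamily (c : 𝔣.Cochain n) (α : Fin (n + 1) → ι) {V : X.Opens}
    (l : V ⟶ face 𝔣.U α) :
    restrictHom l (𝔣.toLocalFamily c α) =
      𝔣.op (α 0) (α (Fin.last n)) V (l.le.trans (face_le 𝔣.U α 0)) (l.le.trans (face_le 𝔣.U α (Fin.last n)))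
        (c.mat α V fun k => l.le.trans (face_le 𝔣.U α k)) := by
  rw [toLocalFamily_apply, restrictHom_op, c.map_mat]

/-- **`(toLocalFamily c)♯ = toEnd n c`.** [folklore] -/
theorem familyHom_toLocalFamily (c : 𝔣.Cochain n) : Cech.familyHom (𝔣.toLocalFamily c) = 𝔣.toEnd n c :=
  Cech.hom_ext_to fun V s α => by
    rw [Cech.familyHom_app_apply, toEnd_app, locOp, ← Category.id_comp (homOfLE _), ← appLE_restrictHom,
      restrictHom_toLocalFamily]

/-- `toLocalFamily 0 = 0`. [folklore] -/
@[simp] theorem toLocalFamily_zero : 𝔣.toLocalFamily (0 : 𝔣.Cochain n) = 0 := by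
  funext α
  rw [toLocalFamily_apply, Cochain.zero_mat, op_zero]
  rfl

/-- `toLocalFamily` is compatible with negation. [folklore] -/
theorem toLocalFamily_neg (c : 𝔣.Cochain n) : 𝔣.toLocalFamily (-c) = -𝔣.toLocalFamily c := by
  funext α
  rw [toLocalFamily_apply, Cochain.neg_mat, Pi.neg_apply, toLocalFamily_apply, ← sub_eq_zero, sub_neg_eq_add,
    ← op_add, neg_add_cancel, op_zero]

/-- `toLocalFamily` is additive. [folklore] -/
theorem toLocalFamily_add (c c' : 𝔣.Cochain n) :
    𝔣.toLocalFamily (c + c') = 𝔣.toLocalFamily c + 𝔣.toLocalFamily c' := by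
  funext α
  rw [toLocalFamily_apply, Cochain.add_mat, op_add]
  rfl

/-- `toLocalFamily` is compatible with subtraction. [folklore] -/
theorem toLocalFamily_sub (c c' : 𝔣.Cochain n) :
    𝔣.toLocalFamily (c - c') = 𝔣.toLocalFamily c - 𝔣.toLocalFamily c' := by
  funext α
  rw [toLocalFamily_apply, Cochain.sub_mat, op_sub]
  rfl

/-- **`toLocalFamily` is injective**: the matrices are recovered from the local endomorphisms
(`op_injective`) and restriction. [folklore] -/
theorem toLocalFamily_injective : Function.Injective (𝔣.toLocalFamily : 𝔣.Cochain n → _) := by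
  intro c c' h
  refine Cochain.ext fun α V hV => ?_
  have hα := congrArg (fun ω : Cech.LocalFamily 𝔣.U n E E => restrictHom (homOfLE (𝔣.le_face_of_forall hV)) (ω α)) h
  simp only [restrictHom_toLocalFamily] at hα
  exact 𝔣.op_injective _ _ V _ _ hα

/-- **`d (toLocalFamily X) = toLocalFamily (D₁X)`** in degree `1`. [folklore] -/
theorem dFamily_toLocalFamily_one (c : 𝔣.Cochain 1) :
    Cech.dFamily (𝔣.toLocalFamily c) = 𝔣.toLocalFamily (𝔣.D₁ c) :=
  Cech.familyHom_injective (by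
    rw [← Cech.familyHom_comp_d, familyHom_toLocalFamily, familyHom_toLocalFamily, toEnd_comp_d_one])

/-- **`d (toLocalFamily X) = toLocalFamily (D₂X)`** in degree `2`. [folklore] -/
theorem dFamily_toLocalFamily_two (c : 𝔣.Cochain 2) :
    Cech.dFamily (𝔣.toLocalFamily c) = 𝔣.toLocalFamily (𝔣.D₂ c) :=
  Cech.familyHom_injective (by
    rw [← Cech.familyHom_comp_d, familyHom_toLocalFamily, familyHom_toLocalFamily, toEnd_comp_d_two])

/-- A matrix `2`-cochain with `D₂X = 0` gives a COCYCLE of local endomorphisms. [folklore] -/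
theorem dFamily_toLocalFamily_eq_zero (c : 𝔣.Cochain 2) (hc : 𝔣.D₂ c = 0) :
    Cech.dFamily (𝔣.toLocalFamily c) = 0 := by
  rw [dFamily_toLocalFamily_two, hc, toLocalFamily_zero]

end Framing

/-! ### The matrix of an endomorphism in a frame -/

section EndMatrix

variable {W V : X.Opens} {I : Type u} [Fintype I] (e : SheafOfModules.free I ≅ E.over W)

/-- **The matrix of an endomorphism `φ` of `E|_V` in a frame `e` of `E|_W`, `V ≤ W`**:
`φ(b_l|_V) = Σ_m A_{ml} b_m|_V`. [cite: Hartshorne1977, II.5 (p. 109)] -/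
def endMatrix (k : V ⟶ W) (φ : E.over V ⟶ E.over V) : Matrix I I Γ(X, V) :=
  Matrix.of fun m l => coord e k (appLE φ (𝟙 V) (E.presheaf.map k.op (basisSection e l))) m

/-- **`matrixEnd e (endMatrix e φ) = φ`**: every endomorphism is the endomorphism of its matrix.
[cite: Hartshorne1977, II.5 (p. 109)] -/
theorem matrixEnd_endMatrix (k : V ⟶ W) (φ : E.over V ⟶ E.over V) :
    matrixEnd e k (endMatrix e k φ) = φ :=
  hom_ext_of_basisSection (SheafOfModules.restrictTrivialisation (R := X.ringCatSheaf) k e) fun l => by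
    rw [basisSection_restrictTrivialisation, appLE_matrixEnd_basisSection]
    exact (eq_sum_coord_smul e k _).symm

/-- The matrix of `matrixEnd A` is `A`. [folklore] -/
theorem endMatrix_matrixEnd (k : V ⟶ W) (A : Matrix I I Γ(X, V)) : endMatrix e k (matrixEnd e k A) = A :=
  matrixEnd_injective e k (matrixEnd_endMatrix e k _)

end EndMatrix

/-! ### Every `1`-cochain of local endomorphisms is a matrix cochain -/

namespace Framing

variable (𝔣 : Framing E ι)

/-- **The matrix `1`-cochain of a family of local endomorphisms**: on `α = (a, b)`,
`X_α = [β_α]_{e_a} · T_{ab}` (so that `op_{ab}(X_α) = matrixEnd_{e_a}([β_α]) = β_α`). [folklore] -/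
def ofLocalFamily₁ (β : Cech.LocalFamily 𝔣.U 1 E E) : 𝔣.Cochain 1 where
  mat α V hV :=
    (endMatrix (𝔣.e (α 0)) (homOfLE (face_le 𝔣.U α 0)) (β α)).map (secRes X (𝔣.le_face_of_forall hV)) *
      𝔣.T (α 0) (α (Fin.last 1)) V (hV 0) (hV (Fin.last 1))
  map_mat α V V' hV h := by
    rw [Matrix.map_mul, Matrix.map_map, T_map]
    congr 1
    · congr 1
      funext x
      exact secRes_secRes _ _ _

/-- **`toLocalFamily (ofLocalFamily₁ β) = β`.** [folklore] -/
theorem toLocalFamily_ofLocalFamily₁ (β : Cech.LocalFamily 𝔣.U 1 E E) :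
    𝔣.toLocalFamily (𝔣.ofLocalFamily₁ β) = β := by
  funext α
  rw [toLocalFamily_apply, op]
  change matrixEnd (𝔣.e (α 0)) _ ((endMatrix (𝔣.e (α 0)) (homOfLE (face_le 𝔣.U α 0)) (β α)).map
    (secRes X (𝔣.le_face_of_forall (face_le 𝔣.U α))) * 𝔣.T (α 0) (α (Fin.last 1)) _ _ _ *
      𝔣.T (α (Fin.last 1)) (α 0) _ _ _) = β α
  have hid : (endMatrix (𝔣.e (α 0)) (homOfLE (face_le 𝔣.U α 0)) (β α)).map
      (secRes X (𝔣.le_face_of_forall (face_le 𝔣.U α))) =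
      endMatrix (𝔣.e (α 0)) (homOfLE (face_le 𝔣.U α 0)) (β α) := by
    ext m l
    exact secRes_self _
  rw [hid, Matrix.mul_assoc, T_mul_symm, Matrix.mul_one, matrixEnd_endMatrix]

/-- **A matrix `2`-cochain whose family of local endomorphisms is a Čech coboundary is `D₁` of a
matrix `1`-cochain.** [folklore] -/
theorem eq_D₁_of_toLocalFamily_eq_dFamily (c : 𝔣.Cochain 2) (β : Cech.LocalFamily 𝔣.U 1 E E)
    (h : 𝔣.toLocalFamily c = Cech.dFamily β) : c = 𝔣.D₁ (𝔣.ofLocalFamily₁ β) :=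
  𝔣.toLocalFamily_injective (by rw [h, ← toLocalFamily_ofLocalFamily₁ 𝔣 β, dFamily_toLocalFamily_one,
    toLocalFamily_ofLocalFamily₁])

end Framing

end Literature.AlgebraicGeometry.Modules

end
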